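import Mathlib.Topology.LocallyConstant.Basic
import Mathlib.Topology.Algebra.Support
import HarnessLib

/-!
# A function that is eventually constant at every point of an open set `U` and vanishes off a closed `K ⊆ U` is locally constant (and compactly supported if `K` is compact)

Topic `Topology`; namespace `Literature.Topology`.  THEOREMS ONLY (no definition, no instance, no notation, no named fact, no `sorry`); Mathlib-only; folklore.
The gluing step (p4) of the PRODUCER of the locally constant, compactly supported representative of the normalised canonical orbital integral on the split torus
(cell `pub/hodgecm-mathlib`, crux H413, line LH6 road (D) brick D3-ii; consumer ★ `Theorems/F0P3cStCharTSShellOrbitalG` p849606, seat LH2-p03 (g3)): there `U` = the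
regular part of the torus (open), where ★ `F0P3cStCharTSShellOrbitalGLocConst` gives eventual constancy, and `K` = the compact set of torus points whose class meets the
shell `K_n b K_n`.  Companion of ★ `LocallyConstantExtendOfEventuallyConst` (dense `U`, extension) — here no extension is needed because the function already vanishes
near `Uᶜ`.  HC_CM is proved only modulo the printed citations until rung 0 closes; this file is pure topology, count-neutral.

* `isLocallyConstant_of_eventually_eq_of_eq_zero_off` — `(∀ x ∈ U, ∀ᶠ y in 𝓝 x, f y = f x) → (∀ x ∉ K, f x = 0) → IsClosed K → K ⊆ U → IsLocallyConstant f`;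
* `isLocallyConstant_and_hasCompactSupport_of_eventually_eq_of_eq_zero_off` — with `K` compact and closed, also `HasCompactSupport f`.

## References
* [Bourbaki, General Topology I] N. Bourbaki, *General Topology*, Ch. I §8.3. [folklore]
* [BernsteinZelevinsky1976] I. N. Bernstein, A. V. Zelevinsky, Russian Math. Surveys 31 (1976), §1.1 (locally constant compactly supported functions).
-/

set_option autoImplicit false

open Topology Filter Set

namespace Literature.Topology

variable {X : Type*} [TopologicalSpace X] {Y : Type*} [Zero Y]

/-- **Gluing local constancy on an open part with vanishing off a closed subset of it.**  If `f` is eventually equal to `f x` near every `x ∈ U`, vanishes off a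
closed `K ⊆ U`, then `f` is locally constant on the whole space (near a point outside `U` — hence outside `K` — `f` vanishes on the open `Kᶜ`).
[cite: BernsteinZelevinsky1976, §1.1] -/
theorem isLocallyConstant_of_eventually_eq_of_eq_zero_off {U K : Set X} {f : X → Y}
    (hloc : ∀ x ∈ U, ∀ᶠ y in 𝓝 x, f y = f x) (hzero : ∀ x ∉ K, f x = 0) (hK : IsClosed K) (hKU : K ⊆ U) :
    IsLocallyConstant f := by
  rw [IsLocallyConstant.iff_eventually_eq]
  intro x
  by_cases hx : x ∈ U
  · exact hloc x hx
  · have hxK : x ∉ K := fun h => hx (hKU h)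
    have hn : Kᶜ ∈ 𝓝 x := hK.isOpen_compl.mem_nhds hxK
    filter_upwards [hn] with y hy
    rw [hzero y hy, hzero x hxK]

/-- **… and compact support** when `K` is compact (and closed): `tsupport f ⊆ K`. [cite: BernsteinZelevinsky1976, §1.1] -/
theorem isLocallyConstant_and_hasCompactSupport_of_eventually_eq_of_eq_zero_off {U K : Set X} {f : X → Y}
    (hloc : ∀ x ∈ U, ∀ᶠ y in 𝓝 x, f y = f x) (hzero : ∀ x ∉ K, f x = 0) (hKc : IsCompact K) (hK : IsClosed K) (hKU : K ⊆ U) :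
    IsLocallyConstant f ∧ HasCompactSupport f :=
  ⟨isLocallyConstant_of_eventually_eq_of_eq_zero_off hloc hzero hK hKU, HasCompactSupport.intro' hKc hK hzero⟩

end Literature.Topology
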